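import Summits.HodgeConjecture.HodgeConjecture.Theorems.F0LD2ArchTypeAwayCore
import HarnessLib

-- As in the lineage (★ `F0P2oCcArchTypeAwayHolds`): the organ's binder list and the theta telescope are large; elaborate sequentially.
set_option Elab.async false

/-!
# Crux `HLiu418`, line LD2 — ORGAN C₂away `ArchTypeAway₂` PAID: [Liu2021, App. D Lem. D.2 (1)] «among the representations `ω^{m,±,l}_{n,0}` only
# `ω^{1,+,0}_{n,0}` and `ω^{−1,−,0}_{n,0}` are the trivial character», read at `n = 2` on a holomorphic-cotangent theta lift from a hermitian LINE:
# the raw archimedean table `(m, sign) ∈ {(−1, −), (1, +)}` at every embedding `τ′` off the place of `ι`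

Cell hodgecm-mathlib (D-0151), FLOOR 0; crux item `HLiu418` = stmt-HodgeConjecture-24832 (route `HCCMUnconditional`); half-A line LD2 (socket 27458
`Cruxes/HLiu418/Lines/F0_AlbCm.lean`, printed stub `stub_S1b_facts : Rogawski1990.curveThetaHodgeTypeNecessity_hol` = letter #74, [Liu2021, Rem. D.5]
necessity, holomorphic side), docking STRICTLY BELOW the Paydown cut G2.  ORGAN C₂away `ArchTypeAway₂` of LD2-plan (g0)'s line-first skeleton
(`F0/P6/LD/LD2-plan/g0/StubS1bfacts.inhouse.skeleton.v5.lean` e8da573259aec245 :358–:396, stub `stub_archTypeAway₂` :525): the head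
**`archTypeAway₂_holds`** below has the `def ArchTypeAway₂` text TOKEN FOR TOKEN as its type, so the skeleton closes the stub by
`exact F0LD2ArchTypeAway.archTypeAway₂_holds`.  Seat LA1-p01 (g2) (deal LD2-plan (g0) 2026-09-02T03:20:48Z).  THEOREMS ONLY (no `def`, no instance,
no notation, no named fact, no `sorry`); `--supports stmt-HodgeConjecture-24832`.  HC_CM is proved only modulo the 7 printed citations (2 remaining:
hLiu418 = stmt-HodgeConjecture-24832, h413 = stmt-HodgeConjecture-24833) until rung 0 closes; this file pays ONE organ of ONE in-house line of hLiu418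
and asserts nothing else.

THE STATEMENT (the `n = 2` twin of the letter ★ `Liu2021.meetsThetaLiftFromLine_hol_archTypeAway`, whose `n = 3` instance is PAID ★
`F0P2oCcArchTypeAwayHolds`): in the frame of #74 — `L` CM with `[L:ℚ] ≥ 4`, `ι : L →+* ℂ`, `H ∈ M₂(L)` with a rational SCALED frame
`ᵗ(c̄ g)·(t • H)·g = diag dV` (`t ≠ 0`, `dV` real non-zero), `diag dV` of signature `(1,1)` at `ι` and positive definite at every `τ′` off the place of
`ι`; a cone frame `𝔣` at `w(ι)`; an automorphic measure `μ`; a line `e₁ : Fin 2 × Fin 1 ≃ Fin n′`; an adelic transport `ιA : U(H)(𝔸) →* U(diag dV)(𝔸)`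
PINNED by `↑(ιA k) = g_𝔸⁻¹ · k · g_𝔸`; `[U(diag dV)]` compact — for every discrete `P` of `U(H)`, conjugate-symplectic `μ′` and unit `a′` of `L⁺`:
if `P` MEETS the global theta lift from the hermitian line `⟨a′⟩` at `μ′` along `ιA` (★ `MeetsThetaLiftFromLine L 2 H e₁ dV hdV hdV0 P μ′ hμ′ a′ ιA`)
and is `H¹`-cohomological of Hodge type `(1,0)` at `w(ι)` (★ `IsHolCotangentAt₂ … (cmPlace L ι) 𝔣`), then at every `τ′` with `mk τ′ ≠ mk ι`:
`(exponentAt hμ′.infinityType τ′ = −1 ∧ Im τ′(a′·(2δ)⁻¹) < 0) ∨ (exponentAt hμ′.infinityType τ′ = 1 ∧ 0 < Im τ′(a′·(2δ)⁻¹))`, `δ = imagUnit L`.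

THE PROOF = the `n = 3` Cc road (★ `F0P2oCcArchTypeAwayHolds` over ★ `F0P2oCcThetaFunctionalCovariance`, seats A-p19 (g19), F0P2-p02, F0P3a-p03)
PORTED «ball ↦ cone, `cmAdelicFrameTransport` ↦ pinned `ιA`, `3 ↦ 2`», every transport-dependent input now ★ at rank 2 ∕ abstract `ιA`
(★ `F0LD1ThetaTransportKit` LD1-p01, ★ `F0LD2ThetaTensorClasses` ∕ ★ `F0LD2CurveHolTestVector` ∕ ★ `F0LD2FrameTransportPin` LD2-p02, ★
`F0LD2ThetaTensorCLM` ∕ ★ `F0LD2ThetaKcInvariance` LA1-p01) and every archimedean brick rank-generic ★: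
* (★ `F0LD2ArchTypeAwayCore`, this organ's §1) THE CORE at a definite place `w₀ = cmPlaceOver L v₀ ≠ w₁` for a `P` containing the non-zero class of a
  holomorphic cotangent form at `w₁`: `starProjection_toLp_lineThetaLift_tmul_of_box₂` — covariance of the projected theta functional on box vectors (`U(V_{w₀})`-invariance ★
  `F0LD2ThetaKcInvariance.starProjection_toLp_lineThetaLift_pairRep_adelicSingle₂` + read-back ★ T2 `pairRep_chiSplittingLine_adelicSingle_tmul_of_box` +
  homogeneity ★ `F0LD2ThetaTensorClasses.toLp_lineThetaLift_smul_left`); **`starProjection_toLp_lineThetaLift_tmul_eq_zero_of_pos₂ ∕ _of_neg₂`** — if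
  `(τ_{w₀} ± 1)/2 ≠ 0` the projected theta functional vanishes on pure tensors (★ T3 `F0LD2ThetaTensorCLM.exists_clm_comp_toLp_lineThetaLift_tmul` CLM;
  ★ β-I± `exists_sectionD_archKPlace_apply_of_pos ∕ _of_neg` + hypothesis `hβII` ⇒ the box law on the Hermite basis with `c = vac`; ★ (G)
  `etaD_mul_vac_archKPlace_of_pos ∕ _of_neg` scalar `η·vac = (det u)^{(τ±1)/2}`; ★ S2 `det_eq_star_pow_of_entries ∕ det_eq_pow_of_entries`; hypothesis
  `hS1`; ★ δ `eq_zero_of_forall_unitaryOpPi_placeBlock_mulSingle_hermitePi` kills `T ∘ frameV⁻¹`, `Nontrivial (Fin n′)` from `n′ = 2`).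
* (this file) THE HEAD `archTypeAway₂_holds`: `[U(H)]` compact (★ `anisotropic_of_formCongr_smul_eq_of_posDef` at a place off `ι`, ★ `exists_infinitePlace_ne`,
  ★ `compactSpace_adelicGroupData_automorphicQuotient`); the transport hypotheses from the pin (★ `continuous_of_pin ∕ mem_range_toAdelic_of_pin`);
  the TEST VECTOR ★ `exists_toLp_ne_zero_of_isHolCotangentAt₂`; the seam unfolded and reduced to a PURE TENSOR `Φ_∞ ⊗ Φ_f` with
  `pr_P [Θ̃_{Φ_∞ ⊗ Φ_f}(f) ∘ ιA] ≠ 0` (★ `exists_tensor_of_apply_toLp_lineThetaLift_ne_zero`, Mathlib `Submodule.starProjection_eq_self_iff` — no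
  `χ`-descent is needed, the core is stated for a general weight `f`); `w₀ := mk τ′ = cmPlaceOver L v₀` (★ `isReal_comap_of_smul_eq`, ★
  `comap_injective_of_isCMField`); `σ_{v₀}(dV p) > 0` read off the letter's `hdef` at `w₀` (`embedding_of_isReal_dV_pos_of_posDef_diagonal`); the sign split
  ★ `forall_signVec_pos_or_forall_not_of_line`; `hS1` ∕ `hβII` discharged by ★ S1 `exists_archLocal_entries_eq_of_pos ∕ _of_neg` and ★ β-II
  `carrierConjEquiv_frameD_placeBlock_mulSingle_doubled_archBoxTensor`; §1 kills the witness unless `τ_{w₀} = ∓1`; the dictionary ★ `exponentAt_embedding ∕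
  exponentAt_conjugate_embedding`, Mathlib `InfinitePlace.mk_eq_iff`, ★ `im_embedding_cmPlaceOver_mul_inv_two_imagUnit` gives the disjunction.

HONEST SCOPE.  Junk check (LD-ref1 criteria): every hypothesis of the organ is consumed — `hmeet` (the witness), `hhol` (test vector + `K_c`-fixing),
`hdef` (compactness + sign split + `σ_{v₀}(dV) > 0`), `h4` (a place off `ι` exists), the pin (transport identities), `ht`∕`hg` (anisotropy, frame);
`hsig` and `𝔣` are idle in the conclusion exactly as `T`, `hT` are idle in ★ Cc at `n = 3` (the away-from-`ι` computation never reads the cone).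
Without `IsHolCotangentAt₂` an antiholomorphic or non-tempered-at-`w₀` `P` breaks the table; without `MeetsThetaLiftFromLine` at THIS `(μ′, a′)` the
table is about an unrelated pair.

## References
* [Liu2021] Y. Liu, *Fourier–Jacobi cycles and arithmetic relative trace formula*, Camb. J. Math. 9 (2021) = arXiv:2102.11518: App. D Lem. D.2 (1)
  (p. 127, l. 5283: «among the representations `ω^{m,±,l}_{n,0}`, only `ω^{1,+,0}_{n,0}` and `ω^{−1,−,0}_{n,0}` are the trivial character»), proof of
  Prop. 4.13 Case 1 (l. 2137–2141, p. 48), Rem. 4.2 ∕ Def. 4.3; proof of Prop. D.4 (1) (p. 130–131), Rem. D.5 (p. 131).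
* [KonnoKonno2007] T. Konno, K. Konno, Kyushu J. Math. 61 (2007), Thm. 5.4, Lemma 5.2.  [KashiwaraVergne1978] Invent. Math. 44 (1978), (5.1)–(5.5).
* [Folland1989] G. Folland, *Harmonic Analysis in Phase Space* (1989), Prop. (4.39), (4.76).  [Rallis1984] Compositio Math. 51 (1984), Thm. 1.2.2 p. 356.
* [GelbartRogawski1991] S. Gelbart, J. Rogawski, Invent. Math. 105 (1991), §3.1 Prop. 3.1.1 p. 455.  [BorelJacquet1979] PSPM 33.1 (1979), §4.1, §4.6.
* [PlatonovRapinchuk1994] V. Platonov, A. Rapinchuk, *Algebraic Groups and Number Theory* (1994), §2.3, §5.3 Thm. 5.5.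
-/

set_option autoImplicit false
-- the mandated namespace has the single-problem summit's repeated segment (`HodgeConjecture.HodgeConjecture`)
set_option linter.dupNamespace false

noncomputable section

open NumberField NumberField.InfinitePlace MeasureTheory IsDedekindDomain
open scoped Matrix ComplexOrder ENNReal TensorProduct SchwartzMap Kronecker Classical

namespace Summit.HodgeConjecture.HodgeConjecture.Cruxes.HLiu418.F0LD2ArchTypeAway

open _root_.MeasureTheory
open Literature.NumberTheory.Automorphic Literature.NumberTheory.Automorphic.UnitaryGroup
open Literature.NumberTheory.Automorphic.UnitaryGroup.CotangentForms
open Literature.NumberTheory.Automorphic.UnitaryCurveForms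
open Literature.NumberTheory.Automorphic.IdeleClassGroup
open Literature.NumberTheory.Automorphic.Liu2021
open Literature.NumberTheory.Automorphic.Liu2021.Def411WeilCarriers
open Literature.NumberTheory.Automorphic.Liu2021.Def411WeilCarriersDoubling
open Literature.NumberTheory.GelbartRogawski1991 Literature.NumberTheory.GelbartRogawski1991.UnitaryDualPair
open Literature.NumberTheory.GelbartRogawski1991.GRConstruction
open Literature.NumberTheory.Weil1964
open Literature.RepresentationTheory.Liu2021
open Literature.RepresentationTheory.HeisenbergGroup Literature.Analysis.SegalBargmann
open Literature.RepresentationTheory.KonnoKonno2007 Literature.RepresentationTheory.CompactGroups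
open F0LD2ArchTypeAwayCore

/-! ## The head: organ C₂away `ArchTypeAway₂` of the LD2 skeleton, token for token -/

/-- `σ_{v₀}(dV p) > 0` read DIRECTLY off the positivity of `diag dV` at the complex place over `v₀` (the letters' binder «definite off the place of `ι`»):
Mathlib `Matrix.posDef_diagonal_iff` and `re σ_w = σ_{v₀}` on `L⁺` (★ `realPlaceMap_eq_embedding_of_isReal`) — the tail of ★
`Liu2021.Def411WeilCarriers.embedding_of_isReal_dV_pos_of_posDef` without the frame. [cite: Liu2021, App. D Lem. D.2 (1)] [cite: PlatonovRapinchuk1994, §2.3] -/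
theorem embedding_of_isReal_dV_pos_of_posDef_diagonal (L : Type) [Field L] [NumberField L] [IsCMField L] {N : ℕ} (dV : Fin N → L)
    (hdV : ∀ i, IsCMField.complexConj L (dV i) = dV i) (v₀ : {v : InfinitePlace (↥(maximalRealSubfield L)) // v.IsReal})
    (hH : ((Matrix.diagonal dV).map (cmPlaceOver L v₀).1.embedding).PosDef) (p : Fin N) :
    0 < embedding_of_isReal v₀.2 (⟨dV p, (IsCMField.complexConj_eq_self_iff (K := L) (dV p)).1 (hdV p)⟩ : Fp L) := by
  have h2 := hH
  rw [Matrix.diagonal_map (map_zero _)] at h2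
  have h3 := (Matrix.posDef_diagonal_iff.1 h2) p
  rw [Complex.pos_iff] at h3
  have h4 := realPlaceMap_eq_embedding_of_isReal L (IsCMField.complexConj L) (cmPlaceOver L v₀) (cmPlaceOver_smul L v₀)
    (IsCMField.complexConj_ne_one L) v₀ (cmPlaceOver_comap L v₀)
    (⟨dV p, (IsCMField.complexConj_eq_self_iff (K := L) (dV p)).1 (hdV p)⟩ : Fp L)
  rw [← h4]
  exact h3.1

set_option maxHeartbeats 4000000 in
-- (the organ's binder list and the theta telescope are large; every step is a named ★ lemma — as ★ `F0P2oCcArchTypeAwayHolds`)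
/-- **ORGAN C₂away `ArchTypeAway₂` HOLDS — [Liu2021, App. D Lem. D.2 (1)] at `n = 2` off the place of `ι`**: in the frame of letter #74 (CM field `L` with
`[L:ℚ] ≥ 4`, scaled rational frame `ᵗ(c̄ g)·(t • H)·g = diag dV`, `diag dV` of signature `(1,1)` at `ι` and definite elsewhere, pinned adelic transport
`ιA`, `[U(diag dV)]` compact), a discrete `P` of `U(H)` MEETING the global theta lift from the hermitian line `⟨a′⟩` at the conjugate-symplectic `μ′` along
`ιA` and `H¹`-COHOMOLOGICAL OF HODGE TYPE `(1,0)` at `w(ι)` has, at every embedding `τ′` off the place of `ι`, raw archimedean parameters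
`(m, sign) ∈ {(−1, −), (1, +)}` — «among the representations `ω_{n,0}^{m,±,l}`, only `ω_{n,0}^{1,+,0}` and `ω_{n,0}^{−1,−,0}` are the trivial character»
(`P_{w₀}` is trivial at the definite place `w₀ = w(τ′)`, so the `U(V_{w₀})`-coinvariants of the theta functional see only the trivial `K`-type).  The type
is the `def ArchTypeAway₂` of the LD2 skeleton (ED. 5 e8da573259aec245 :358–:396) verbatim; the proof is the `n = 3` Cc road ported (module docstring).
[cite: Liu2021, App. D Lem. D.2 (1) (p. 127, l. 5283); Prop. 4.13 proof Case 1 (l. 2137–2141, p. 48); Rem. 4.2 ∕ Def. 4.3]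
[cite: KonnoKonno2007, Thm. 5.4] [cite: KashiwaraVergne1978, (5.1)–(5.5)] [cite: Folland1989, Prop. (4.76)] [cite: BorelJacquet1979, §4.6] -/
theorem archTypeAway₂_holds :
  ∀ (L : Type) [Field L] [NumberField L] [IsCMField L] (ι : L →+* ℂ) (H : Matrix (Fin 2) (Fin 2) L)
    (dV : Fin 2 → L) (hdV : ∀ i, IsCMField.complexConj L (dV i) = dV i) (hdV0 : ∀ i, dV i ≠ 0)
    (t : L) (ht : t ≠ 0) (g : GL (Fin 2) L)
    (hg : formCongr ((IsCMField.complexConj L : L ≃ₐ[↥(maximalRealSubfield L)] L) : L →+* L) g (t • H) = Matrix.diagonal dV),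
    (∃ T : GL (Fin 2) ℂ, formCongr (starRingEnd ℂ) T ((Matrix.diagonal dV).map ι) = Matrix.diagonal ![(1 : ℂ), -1]) →
    (∀ τ' : L →+* ℂ, InfinitePlace.mk τ' ≠ InfinitePlace.mk ι → ((Matrix.diagonal dV).map τ').PosDef) →
    4 ≤ Module.finrank ℚ L →
    ∀ (𝔣 : ConeFrame L H (cmPlace L ι))
      (μ : Measure (adelicGroupData (↥(maximalRealSubfield L)) L (IsCMField.complexConj L) 2 H).automorphicQuotient)
      [(adelicGroupData (↥(maximalRealSubfield L)) L (IsCMField.complexConj L) 2 H).IsAutomorphicMeasure μ]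
      {n' : ℕ} (e₁ : Fin 2 × Fin 1 ≃ Fin n')
      (ιA : (adelicGroupData (↥(maximalRealSubfield L)) L (IsCMField.complexConj L) 2 H).Adelic →*
        ↥(UnitaryGroup.adelic (↥(maximalRealSubfield L)) L (IsCMField.complexConj L) 2 (Matrix.diagonal dV))),
      (∀ k, ((ιA k : ↥(UnitaryGroup.adelic (↥(maximalRealSubfield L)) L (IsCMField.complexConj L) 2 (Matrix.diagonal dV))) :
            GL (Fin 2) (AdeleRing (𝓞 L) L)) =
          (toAdeleGL L g)⁻¹ * adelicVal (↥(maximalRealSubfield L)) L (IsCMField.complexConj L) 2 H k * toAdeleGL L g) →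
    ∀ [CompactSpace (↥(UnitaryGroup.adelic (↥(maximalRealSubfield L)) L (IsCMField.complexConj L) 2 (Matrix.diagonal dV)) ⧸
        (UnitaryGroup.toAdelic (↥(maximalRealSubfield L)) L (IsCMField.complexConj L) 2 (Matrix.diagonal dV)).range)],
    ∀ (P : DiscreteAutomorphicRep (adelicGroupData (↥(maximalRealSubfield L)) L (IsCMField.complexConj L) 2 H) μ)
      (μ' : Literature.NumberTheory.Automorphic.IdeleClassGroup L →ₜ* Circle) (hμ' : IsConjugateSymplectic L μ')
      (a' : (↥(maximalRealSubfield L))ˣ),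
      MeetsThetaLiftFromLine L 2 H e₁ dV hdV hdV0 P μ' hμ' a' ιA →
      P.IsHolCotangentAt₂ (IsCMField.complexConj_ne_one L) (UnitaryGroup.complexConj_smul_infinitePlace L) (cmPlace L ι) 𝔣 →
      ∀ τ' : L →+* ℂ, InfinitePlace.mk τ' ≠ InfinitePlace.mk ι →
        (exponentAt hμ'.infinityType τ' = -1 ∧ (τ' (algebraMap (↥(maximalRealSubfield L)) L a' * (2 * imagUnit L)⁻¹)).im < 0) ∨
          (exponentAt hμ'.infinityType τ' = 1 ∧ 0 < (τ' (algebraMap (↥(maximalRealSubfield L)) L a' * (2 * imagUnit L)⁻¹)).im) := by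
  intro L _ _ _ ι H dV hdV hdV0 t ht g hg _hsig hdef h4 𝔣 μA _ n' e₁ ιA hpin _ P μ hμ a hmeet hhol τ' hτ'
  -- `[U(H)]` is compact: `H` is anisotropic, being similar (scaled frame) to `diag dV`, definite at a place off `ι`
  obtain ⟨τc, hτc⟩ := UnitaryGroup.exists_infinitePlace_ne L h4 ι
  haveI : CompactSpace (adelicGroupData (↥(maximalRealSubfield L)) L (IsCMField.complexConj L) 2 H).automorphicQuotient :=
    UnitaryGroup.compactSpace_adelicGroupData_automorphicQuotient L 2 H
      (UnitaryGroup.anisotropic_of_formCongr_smul_eq_of_posDef L 2 H dV t ht g hg τc (hdef τc hτc))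
  -- the transport hypotheses of the pinned `ιA`
  have hιA : Continuous ιA ∧ ∀ ⦃γ : (adelicGroupData (↥(maximalRealSubfield L)) L (IsCMField.complexConj L) 2 H).Adelic⦄,
      γ ∈ (UnitaryGroup.toAdelic (↥(maximalRealSubfield L)) L (IsCMField.complexConj L) 2 H).range →
        ιA γ ∈ (UnitaryGroup.toAdelic (↥(maximalRealSubfield L)) L (IsCMField.complexConj L) 2 (Matrix.diagonal dV)).range :=
    ⟨F0LD2FrameTransportPin.continuous_of_pin L 2 H dV g ιA hpin,
      fun _ hγ => F0LD2FrameTransportPin.mem_range_toAdelic_of_pin L 2 H dV t ht g hg ιA hpin hγ⟩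
  -- the TEST VECTOR: a non-zero class of a holomorphic cotangent form in `P`
  obtain ⟨fh, hfh, hj, hjmem, hjne⟩ := F0LD2CurveHolTestVector.exists_toLp_ne_zero_of_isHolCotangentAt₂ P hhol
  -- the seam, unfolded
  letI : MeasurableSpace (↥(UnitaryGroup.adelic (↥(maximalRealSubfield L)) L (IsCMField.complexConj L) 1 (JW (↥(maximalRealSubfield L)) L a)) ⧸ (UnitaryGroup.toAdelic (↥(maximalRealSubfield L)) L (IsCMField.complexConj L) 1 (JW (↥(maximalRealSubfield L)) L a)).range) := borel _
  haveI : BorelSpace (↥(UnitaryGroup.adelic (↥(maximalRealSubfield L)) L (IsCMField.complexConj L) 1 (JW (↥(maximalRealSubfield L)) L a)) ⧸ (UnitaryGroup.toAdelic (↥(maximalRealSubfield L)) L (IsCMField.complexConj L) 1 (JW (↥(maximalRealSubfield L)) L a)).range) := ⟨rfl⟩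
  haveI := normal_range_toAdelic_JW L a
  obtain ⟨hρ, μW, hfinm, hinv, f, Φ, hθ, hθmem, hθne⟩ := hmeet
  haveI : IsFiniteMeasure μW := hfinm
  haveI : SMulInvariantMeasure ↥(UnitaryGroup.adelic (↥(maximalRealSubfield L)) L (IsCMField.complexConj L) 1 (JW (↥(maximalRealSubfield L)) L a)) (↥(UnitaryGroup.adelic (↥(maximalRealSubfield L)) L (IsCMField.complexConj L) 1 (JW (↥(maximalRealSubfield L)) L a)) ⧸ (UnitaryGroup.toAdelic (↥(maximalRealSubfield L)) L (IsCMField.complexConj L) 1 (JW (↥(maximalRealSubfield L)) L a)).range) μW := hinv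
  -- PURE-TENSOR witness with non-zero projection (no `χ`-descent: the core is stated for a general weight `f`)
  have hθ' : (P.space.toSubmodule.starProjection : Lp ℂ 2 μA →ₗ[ℂ] Lp ℂ 2 μA)
      (MemLp.toLp _ (F0LD1ThetaTransportKit.memLp_toQuotFun_lineThetaLift L 2 H e₁ dV hdV hdV0 ιA hιA μ hμ a hρ μW Φ f μA 2)) ≠ 0 := by
    have hrw : MemLp.toLp _ (F0LD1ThetaTransportKit.memLp_toQuotFun_lineThetaLift L 2 H e₁ dV hdV hdV0 ιA hιA μ hμ a hρ μW Φ f μA 2) =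
        MemLp.toLp _ hθ := rfl
    rw [hrw, ContinuousLinearMap.coe_coe, Submodule.starProjection_eq_self_iff.mpr hθmem]
    exact hθne
  obtain ⟨Φinf, Φfin, hfin, hne⟩ := F0LD2ThetaTensorClasses.exists_tensor_of_apply_toLp_lineThetaLift_ne_zero L 2 H e₁ dV hdV hdV0 ιA hιA μ hμ a hρ
    μW f μA (P.space.toSubmodule.starProjection : Lp ℂ 2 μA →ₗ[ℂ] Lp ℂ 2 μA) Φ hθ'
  -- the witness as `E(Φ_∞ ⊗ Φ_f)`
  have hΨ : piSchwartzBruhatEquiv (↥(maximalRealSubfield L)) (Fin n') (Φinf ⊗ₜ[ℂ] (⟨Φfin, hfin⟩ : FinSB (↥(maximalRealSubfield L)) (Fin n'))) =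
      ⟨fun v => Φinf (piArch (↥(maximalRealSubfield L)) (Fin n') v) * Φfin (piFinite (↥(maximalRealSubfield L)) (Fin n') v),
        tensor_mem_piSchwartzBruhat Φinf hfin⟩ :=
    Subtype.ext (coe_piSchwartzBruhatEquiv_tmul (↥(maximalRealSubfield L)) (Fin n') Φinf ⟨Φfin, hfin⟩)
  -- the place of `τ′` and the real place below it
  let w₀ : {w : InfinitePlace L // w.IsComplex} := ⟨InfinitePlace.mk τ', IsTotallyComplex.isComplex _⟩
  let v₀ : {v : InfinitePlace (↥(maximalRealSubfield L)) // v.IsReal} :=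
    ⟨w₀.1.comap (algebraMap (↥(maximalRealSubfield L)) L),
      Literature.NumberTheory.GelbartRogawski1991.UnitaryDualPair.ArchSplitting.QuadExt.isReal_comap_of_smul_eq (F := ↥(maximalRealSubfield L))
        (E := L) (c := IsCMField.complexConj L) (w := w₀) (complexConj_smul_infinitePlace L _) (IsCMField.complexConj_ne_one L)⟩
  have hw₀ : (cmPlaceOver L v₀).1 = InfinitePlace.mk τ' :=
    comap_injective_of_isCMField (L := L) (cmPlaceOver_comap L v₀)
  have hw₀' : (cmPlaceOver L v₀).1 ≠ InfinitePlace.mk ι := hw₀ ▸ hτ'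
  have hw₀'' : cmPlaceOver L v₀ ≠ cmPlace L ι := fun h => hw₀' (by rw [h])
  -- the archimedean type of `toHeckeCharacter μ`
  have hτ : (toHeckeCharacter L μ).HasUnitaryArchType hμ.infinityType 0 :=
    (hasUnitaryArchType_toHeckeCharacter_iff L μ _).2 hμ.hasInfinityType_infinityType
  have hodd : ∀ w, Odd (hμ.infinityType w) := hμ.odd_infinityType
  -- positivity of `σ_{v₀}(dV p)` (the letter's `hdef` at `w₀`) and the sign split at `v₀`
  have hH : ((Matrix.diagonal dV).map (cmPlaceOver L v₀).1.embedding).PosDef :=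
    hdef _ (by rw [InfinitePlace.mk_embedding]; exact hw₀')
  have hVpos := embedding_of_isReal_dV_pos_of_posDef_diagonal L dV hdV v₀ hH
  -- the dictionary at `τ′`: `τ′ = σ_{w₀}` or its conjugate
  have hmk : InfinitePlace.mk τ' = InfinitePlace.mk (cmPlaceOver L v₀).1.embedding := by rw [InfinitePlace.mk_embedding, hw₀]
  have hτ'or : τ' = (cmPlaceOver L v₀).1.embedding ∨ τ' = NumberField.ComplexEmbedding.conjugate (cmPlaceOver L v₀).1.embedding := by
    rcases InfinitePlace.mk_eq_iff.1 hmk with h | h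
    · exact Or.inl h
    · refine Or.inr (RingHom.ext fun z => ?_)
      have hz := congrArg (fun φ : L →+* ℂ => φ z) h
      simp only [NumberField.ComplexEmbedding.conjugate_coe_eq] at hz
      rw [NumberField.ComplexEmbedding.conjugate_coe_eq, ← hz, Complex.conj_conj]
  have hIm : ((cmPlaceOver L v₀).1.embedding (algebraMap (↥(maximalRealSubfield L)) L a * (2 * imagUnit L)⁻¹)).im =
      -embedding_of_isReal v₀.2 (a : ↥(maximalRealSubfield L)) / (2 * deltaIm (cmPlaceOver L) (imagUnit L) v₀) :=
    im_embedding_cmPlaceOver_mul_inv_two_imagUnit L v₀ (a : ↥(maximalRealSubfield L))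
  have hImc : (NumberField.ComplexEmbedding.conjugate (cmPlaceOver L v₀).1.embedding
        (algebraMap (↥(maximalRealSubfield L)) L a * (2 * imagUnit L)⁻¹)).im =
      embedding_of_isReal v₀.2 (a : ↥(maximalRealSubfield L)) / (2 * deltaIm (cmPlaceOver L) (imagUnit L) v₀) := by
    rw [NumberField.ComplexEmbedding.conjugate_coe_eq, Complex.conj_im, hIm, neg_div, neg_neg]
  -- the sign of `x_{v₀}` read on `σ_{v₀}(a) / c_{v₀}` (S3a at `k := e₁ (p, 0)`)
  have hsign : ∀ p : Fin 2, signVec (cmPlaceOver L) (cmGramEntry L e₁ dV hdV (lineW L (TW (↥(maximalRealSubfield L)) a))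
      (complexConj_lineW L (TW (↥(maximalRealSubfield L)) a))) (imagUnit L) v₀ (e₁ (p, 0)) =
      embedding_of_isReal v₀.2 (⟨dV p, (IsCMField.complexConj_eq_self_iff (K := L) (dV p)).1 (hdV p)⟩ : ↥(maximalRealSubfield L)) *
        (embedding_of_isReal v₀.2 (a : ↥(maximalRealSubfield L)) / deltaIm (cmPlaceOver L) (imagUnit L) v₀) := fun p => by
    rw [signVec_cmGramEntry_eq, Equiv.symm_apply_apply, mul_div_assoc]
    rfl
  have hd0 : deltaIm (cmPlaceOver L) (imagUnit L) v₀ ≠ 0 :=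
    deltaIm_ne_zero (IsCMField.complexConj_ne_one L) (cmPlaceOver_smul L) (complexConj_imagUnit L) (imagUnit_ne_zero L) v₀
  -- the core: kill the witness unless the exponent at `w₀` is right
  have hkill : ∀ {ε : ℤ}, (∀ (Φf : FinSB (↥(maximalRealSubfield L)) (Fin n')) (φ : 𝓢((Fin n' → mixedEmbedding.mixedSpace ↥(maximalRealSubfield L)), ℂ)),
      ε ≠ 0 → P.space.toSubmodule.starProjection (MemLp.toLp _ (F0LD1ThetaTransportKit.memLp_toQuotFun_lineThetaLift L 2 H e₁ dV hdV hdV0 ιA hιA μ hμ a hρ μW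
        (piSchwartzBruhatEquiv (↥(maximalRealSubfield L)) (Fin n') (φ ⊗ₜ Φf)) f μA 2)) = 0) → ε = 0 := by
    intro ε hcore
    by_contra hε
    apply hne
    rw [← F0LD2ThetaTensorClasses.toLp_lineThetaLift_congr L 2 H e₁ dV hdV hdV0 ιA hιA μ hμ a hρ μW f μA hΨ]
    exact hcore ⟨Φfin, hfin⟩ Φinf hε
  rcases forall_signVec_pos_or_forall_not_of_line L dV hdV v₀ e₁ (lineW L (TW (↥(maximalRealSubfield L)) a))
    (complexConj_lineW L (TW (↥(maximalRealSubfield L)) a)) hVpos with hpos | hneg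
  · -- POSITIVE at `v₀`: `τ_{w₀} = −1` and `Im σ_{w₀}(a·(2δ)⁻¹) < 0`
    have hτw : hμ.infinityType (cmPlaceOver L v₀).1 = -1 := by
      obtain ⟨m, hm'⟩ := hodd (cmPlaceOver L v₀).1
      have h0 : (hμ.infinityType (cmPlaceOver L v₀).1 + 1) / 2 = 0 :=
        hkill fun Φf φ hm0 => starProjection_toLp_lineThetaLift_tmul_eq_zero_of_pos₂ L H e₁ dV hdV hdV0 t ht g hg ιA hιA hpin μ hμ a hρ μW f
          (cmPlace L ι) 𝔣 P hfh hj hjmem hjne v₀ hw₀'' hτ hodd hpos hm0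
          (fun A => exists_archLocal_entries_eq_of_pos L e₁ dV hdV hdV0 (lineW L (TW (↥(maximalRealSubfield L)) a))
            (complexConj_lineW L (TW (↥(maximalRealSubfield L)) a)) (lineW_ne_zero L (TW (↥(maximalRealSubfield L)) a) (isUnit_det_TW (↥(maximalRealSubfield L)) a))
            v₀ hpos A)
          (fun W β => carrierConjEquiv_frameD_placeBlock_mulSingle_doubled_archBoxTensor L e₁ dV hdV hdV0 (lineW L (TW (↥(maximalRealSubfield L)) a))
            (complexConj_lineW L (TW (↥(maximalRealSubfield L)) a)) (lineW_ne_zero L (TW (↥(maximalRealSubfield L)) a) (isUnit_det_TW (↥(maximalRealSubfield L)) a))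
            W v₀ β 0)
          Φf φ
      omega
    -- the sign: `0 < σ_{v₀}(a) / c_{v₀}`
    have hs : 0 < embedding_of_isReal v₀.2 (a : ↥(maximalRealSubfield L)) / deltaIm (cmPlaceOver L) (imagUnit L) v₀ := by
      have h := hpos (e₁ ((0 : Fin 2), 0))
      rw [hsign] at h
      exact (mul_pos_iff_of_pos_left (hVpos 0)).1 h
    rcases hτ'or with hτ'eq | hτ'eq
    · left
      refine ⟨by rw [hτ'eq, exponentAt_embedding, hτw], ?_⟩
      rw [hτ'eq, hIm, neg_div, neg_lt_zero, mul_comm (2 : ℝ), ← div_div]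
      exact div_pos hs two_pos
    · right
      refine ⟨by rw [hτ'eq, exponentAt_conjugate_embedding _ (cmPlaceOver L v₀).2, hτw]; norm_num, ?_⟩
      rw [hτ'eq, hImc, mul_comm (2 : ℝ), ← div_div]
      exact div_pos hs two_pos
  · -- NEGATIVE at `v₀`: `τ_{w₀} = 1` and `0 < Im σ_{w₀}(a·(2δ)⁻¹)`
    have hτw : hμ.infinityType (cmPlaceOver L v₀).1 = 1 := by
      obtain ⟨m, hm'⟩ := hodd (cmPlaceOver L v₀).1
      have h0 : (1 - hμ.infinityType (cmPlaceOver L v₀).1) / 2 = 0 :=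
        hkill fun Φf φ hm0 => starProjection_toLp_lineThetaLift_tmul_eq_zero_of_neg₂ L H e₁ dV hdV hdV0 t ht g hg ιA hιA hpin μ hμ a hρ μW f
          (cmPlace L ι) 𝔣 P hfh hj hjmem hjne v₀ hw₀'' hτ hodd hneg hm0
          (fun A => exists_archLocal_entries_eq_of_neg L e₁ dV hdV hdV0 (lineW L (TW (↥(maximalRealSubfield L)) a))
            (complexConj_lineW L (TW (↥(maximalRealSubfield L)) a)) (lineW_ne_zero L (TW (↥(maximalRealSubfield L)) a) (isUnit_det_TW (↥(maximalRealSubfield L)) a))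
            v₀ hneg A)
          (fun W β => carrierConjEquiv_frameD_placeBlock_mulSingle_doubled_archBoxTensor L e₁ dV hdV hdV0 (lineW L (TW (↥(maximalRealSubfield L)) a))
            (complexConj_lineW L (TW (↥(maximalRealSubfield L)) a)) (lineW_ne_zero L (TW (↥(maximalRealSubfield L)) a) (isUnit_det_TW (↥(maximalRealSubfield L)) a))
            W v₀ β 0)
          Φf φ
      omega
    -- the sign: `σ_{v₀}(a) / c_{v₀} < 0`
    have hs : embedding_of_isReal v₀.2 (a : ↥(maximalRealSubfield L)) / deltaIm (cmPlaceOver L) (imagUnit L) v₀ < 0 := by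
      have h := hneg (e₁ ((0 : Fin 2), 0))
      rw [hsign] at h
      have hne0 : embedding_of_isReal v₀.2 (a : ↥(maximalRealSubfield L)) / deltaIm (cmPlaceOver L) (imagUnit L) v₀ ≠ 0 :=
        div_ne_zero ((map_ne_zero _).2 (Units.ne_zero a)) hd0
      rcases lt_trichotomy (embedding_of_isReal v₀.2 (a : ↥(maximalRealSubfield L)) / deltaIm (cmPlaceOver L) (imagUnit L) v₀) 0 with hlt | heq | hgt
      · exact hlt
      · exact absurd heq hne0
      · exact absurd (mul_pos (hVpos 0) hgt) h
    rcases hτ'or with hτ'eq | hτ'eq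
    · right
      refine ⟨by rw [hτ'eq, exponentAt_embedding, hτw], ?_⟩
      rw [hτ'eq, hIm, neg_div, mul_comm (2 : ℝ), ← div_div]
      exact neg_pos.2 (div_neg_of_neg_of_pos hs two_pos)
    · left
      refine ⟨by rw [hτ'eq, exponentAt_conjugate_embedding _ (cmPlaceOver L v₀).2, hτw], ?_⟩
      rw [hτ'eq, hImc, mul_comm (2 : ℝ), ← div_div]
      exact div_neg_of_neg_of_pos hs two_pos

end Summit.HodgeConjecture.HodgeConjecture.Cruxes.HLiu418.F0LD2ArchTypeAway

end
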